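import Summits.Ventures.Crystal3D.Theorems.StickyWulffConstantPolycrystalWulffBoundGapCellsChimera

/-!
# `PolycrystalWulffBound`, line `PolyDensity`: the REDUCTION rung `rung_gapCells` — for ANY cell complex,
# gap-feasible sorted targets give `6·2^{1/3}(√2·Vol)^{2/3} ≤ Fr + Σ_{j≠j'} t_{jj'}·facetArea`
# (the all-pairs gap-sorted chimera; crux `stmt-Ventures-19482`)

Route `StickyWulffConstant` of the venture `Summits/Ventures/Crystal3D`, second prover lane (poly-p2,
gen 14).  This is the general form of the gap-sorted engine (memo P-GAP-g14 §4): no tree, no axis, no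
separation of non-adjacent cells.  DATA: cells `Q_j` (bounded open `H`-polytopes), frames `A_j`, and for
every ordered pair `j ≠ j'` a unit normal `nv j j'` and a level `b j j'` (both antisymmetric) such that the
plane `{⟪nv j j', x⟫ = b j j'}` SEPARATES the two cells (`Q_j ⊆ {⟪nv j j', x⟫ < b j j'}`); per ordered
pair a TRIM DEPTH `t j j' ≥ 0` and a TARGET THRESHOLD `τ j j'` with `τ j j' + τ j' j ≤ t j j' + t j' j`.
HYPOTHESIS (gap feasibility, the one quantitative input): for every cell,
`|W(A_j) ∩ ⋂_{j' ≠ j} {⟪y, nv j j'⟫ ≤ τ j j'}| ≥ 32·|Q_j| / |⋃ Q|`.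
CONCLUSION: `6·2^{1/3}(√2·Vol)^{2/3} ≤ Fr + Σ_j Σ_{j' ≠ j} t j j' · facetArea(cl Q_j ∩ {⟪nv j j', x⟫ = b j j'})`.
PROOF: trim along every separating plane (`volume_sepSlab_le`: the loss is `r·t·(facetArea + ε)`, ZERO to
first order at edge/vertex contacts — junction lines cost nothing), sort the targets
(`gapCells_chimera_lower`), Minkowski-content upper bound, `r → 0`.
READING: `stub_polyhedral` on a class ⇐ GAP FEASIBILITY there with `t` inside the law (`0` / `(1/√6)sin∠` /
`≤ 1`); trees always (`rung_gapTree`); cycles = a finite-dimensional question per class (memo P-GAP-g14 §4).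
WHAT THIS IS NOT: a feasibility theorem; the crux is not claimed.
-/

noncomputable section

open scoped BigOperators InnerProductSpace ENNReal Pointwise
open MeasureTheory Filter Set

namespace Summit.Ventures.Crystal3D.Cruxes.PolycrystalWulffBound.PolyDensity

open Summit.Ventures.Crystal3D.Theorems
open Summit.Ventures.Crystal3D.Cruxes.TextureLiminf.TexShadow (per polytope facetArea E3)
open Literature.MathematicalPhysics.StatisticalMechanics (fccStacking barlowStacking IsHaggSeq perimeter)

set_option maxHeartbeats 800000 in  -- one long assembly proof (trims, targets, disjointness, limit)
/-- **Rung `rung_gapCells`** (the reduction of the polyhedral Wulff bound on an arbitrary cell complex to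
gap feasibility of sorted targets): see the module docstring. -/
theorem rung_gapCells : let Λ : Set (EuclideanSpace ℝ (Fin 3)) := Literature.MathematicalPhysics.StatisticalMechanics.fccStacking 1 (Real.sqrt (2 / 3)); let Φ : EuclideanSpace ℝ (Fin 3) → ℝ := fun ν => Real.sqrt 2 / 4 * ∑ᶠ w ∈ {w ∈ Λ | ‖w‖ = 1}, |⟪w, ν⟫_ℝ|; let Per : Set (EuclideanSpace ℝ (Fin 3)) → Set (EuclideanSpace ℝ (Fin 3)) → ℝ := fun K S => (⨆ (ξ : EuclideanSpace ℝ (Fin 3) → EuclideanSpace ℝ (Fin 3)) (_ : ContDiff ℝ 1 ξ ∧ HasCompactSupport ξ ∧ ∀ z, ξ z ∈ K), ENNReal.ofReal (∫ z in S, Literature.MathematicalPhysics.StatisticalMechanics.fieldDivergence ξ z)).toReal; let ι : Set (EuclideanSpace ℝ (Fin 3)) → Set (EuclideanSpace ℝ (Fin 3)) → Set (EuclideanSpace ℝ (Fin 3)) → ℝ := fun K S₁ S₂ => (Per K S₁ + Per K S₂ - Per K (S₁ ∪ S₂)) / 2; let W : (EuclideanSpace ℝ (Fin 3) ≃ₗᵢ[ℝ]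 EuclideanSpace ℝ (Fin 3)) → Set (EuclideanSpace ℝ (Fin 3)) := fun A => {y | ∀ ν : EuclideanSpace ℝ (Fin 3), ⟪y, ν⟫_ℝ ≤ Φ (A.symm ν)}; let Vol : (n : ℕ) → (Fin n → Set (EuclideanSpace ℝ (Fin 3))) → ℝ := fun n G => (volume (⋃ f : Fin n, G f)).toReal; let Fr : (n : ℕ) → (Fin n → Set (EuclideanSpace ℝ (Fin 3))) → (Fin n → (EuclideanSpace ℝ (Fin 3) ≃ₗᵢ[ℝ] EuclideanSpace ℝ (Fin 3))) → ℝ := fun n G A => ∑ f : Fin n, Per (W (A f)) (G f) - ∑ f, ∑ g, (if f = g then 0 else ι (W (A f)) (G f) (G g)); ∀ (k : ℕ) (H : Fin k → Finset ((EuclideanSpace ℝ (Fin 3)) × ℝ)) (A : Fin k → (EuclideanSpace ℝ (Fin 3) ≃ₗᵢ[ℝ] EuclideanSpace ℝ (Fin 3))) (nv : Fin k → Fin k → EuclideanSpace ℝ (Fin 3)) (b τ t : Fin k → Fin k → ℝ), (∀ j, Bornology.IsBounded (⋂ p ∈ H j, {x : EuclideanSpace ℝ (Fin 3) | ⟪p.1,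 x⟫_ℝ < p.2})) → (∀ j, ∀ p ∈ H j, ‖p.1‖ = 1) → (∀ i j, nv j i = -nv i j) → (∀ i j, b j i = -b i j) → (∀ j j', j ≠ j' → ‖nv j j'‖ = 1) → (∀ j j', j ≠ j' → (⋂ p ∈ H j, {x : EuclideanSpace ℝ (Fin 3) | ⟪p.1, x⟫_ℝ < p.2}) ⊆ {x | ⟪nv j j', x⟫_ℝ < b j j'}) → (∀ j j', 0 ≤ t j j') → (∀ j j', j ≠ j' → τ j j' + τ j' j ≤ t j j' + t j' j) → (∀ j, ENNReal.ofReal (32 * ((volume (⋂ p ∈ H j, {x : EuclideanSpace ℝ (Fin 3) | ⟪p.1, x⟫_ℝ < p.2})).toReal / Vol k (fun j => ⋂ p ∈ H j, {x : EuclideanSpace ℝ (Fin 3) | ⟪p.1, x⟫_ℝ < p.2}))) ≤ volume (W (A j) ∩ ⋂ j' ∈ Finset.univ.filter (fun j' => j' ≠ j), {y | ⟪y, nv j j'⟫_ℝ ≤ τ j j'})) → 6 * (2 : ℝ) ^ ((1 : ℝ) / 3) * (Real.sqrt 2 * Vol k (fun j => ⋂ p ∈ H j, {x : EuclideanSpace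 ℝ (Fin 3) | ⟪p.1, x⟫_ℝ < p.2})) ^ ((2 : ℝ) / 3) ≤ Fr k (fun j => ⋂ p ∈ H j, {x : EuclideanSpace ℝ (Fin 3) | ⟪p.1, x⟫_ℝ < p.2}) A + ∑ j, ∑ j', (if j = j' then 0 else t j j' * facetArea (closure (⋂ p ∈ H j, {x : EuclideanSpace ℝ (Fin 3) | ⟪p.1, x⟫_ℝ < p.2}) ∩ {x | ⟪nv j j', x⟫_ℝ = b j j'}) (nv j j')) := by
  intro Λ Φ Per ι W Vol Fr k H A nv b τ t hbd hunitH hanti hbanti hunit hsep ht0 hgap hfeas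
  classical
  set Q : Fin k → Set E3 := fun j => ⋂ p ∈ H j, {x : E3 | ⟪p.1, x⟫_ℝ < p.2} with hQ
  have hQpoly : ∀ j, Q j = polytope (H j) := fun j => rfl
  set fa : Fin k → Fin k → ℝ := fun j j' =>
    facetArea (closure (Q j) ∩ {x : E3 | ⟪nv j j', x⟫_ℝ = b j j'}) (nv j j') with hfa
  set Θ : ℝ := ∑ j, ∑ j', (if j = j' then 0 else t j j' * fa j j') with hΘ
  show 6 * (2 : ℝ) ^ ((1 : ℝ) / 3) * (Real.sqrt 2 * (volume (⋃ j, Q j)).toReal) ^ ((2 : ℝ) / 3) ≤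
    (∑ f, Per (W (A f)) (Q f) - ∑ f, ∑ g, (if f = g then 0 else ι (W (A f)) (Q f) (Q g))) + Θ
  rw [← Finset.sum_sub_distrib]
  set F : ℝ := ∑ f, (Per (W (A f)) (Q f) - ∑ g, (if f = g then 0 else ι (W (A f)) (Q f) (Q g))) with hF
  -- basic facts on the cells
  have hQo : ∀ j, IsOpen (Q j) := fun j =>
    isOpen_biInter_finset fun q _ => isOpen_lt (continuous_const.inner continuous_id) continuous_const
  have hQm : ∀ j, MeasurableSet (Q j) := fun j => (hQo j).measurableSet
  have hvolQ : ∀ j, volume (Q j) < ⊤ := by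
    intro j
    obtain ⟨R, hR⟩ := (hbd j).subset_closedBall 0
    exact lt_of_le_of_lt (measure_mono hR) measure_closedBall_lt_top
  have hdisj : ∀ j j', j ≠ j' → Disjoint (Q j) (Q j') := by
    intro j j' hjj'
    rw [Set.disjoint_left]
    intro x hx hx'
    have h1 : ⟪nv j j', x⟫_ℝ < b j j' := hsep j j' hjj' hx
    have h2 : ⟪nv j' j, x⟫_ℝ < b j' j := hsep j' j (Ne.symm hjj') hx'
    rw [hanti j j', hbanti j j', inner_neg_left] at h2
    linarith
  have hPolyQ : ∀ j, ∃ (k' : ℕ) (H' : Fin k' → Finset (E3 × ℝ)), Q j = ⋃ i, polytope (H' i) :=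
    fun j => ⟨1, fun _ => H j, by rw [hQpoly]; ext x; simp⟩
  have hWc : ∀ f, IsCompact (W (A f)) := fun f => isCompact_cruxWulffBody (A f)
  have hWv : ∀ f, Convex ℝ (W (A f)) := fun f => convex_cruxWulffBody (A f)
  have hW0 : ∀ f, (0 : E3) ∈ W (A f) := fun f => zero_mem_cruxWulffBody (A f)
  have hWs : ∀ f, -W (A f) = W (A f) := fun f => neg_cruxWulffBody_eq (A f)
  have hWm : ∀ f, MeasurableSet (W (A f)) := fun f => (hWc f).isClosed.measurableSet
  have hFr0 : 0 ≤ F := by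
    have h := freeEnergy_ge_mul_perimeter Q hPolyQ hvolQ hdisj (fun f => W (A f)) hWc hWv hW0 hWs
      (Real.sqrt_pos.2 (by norm_num : (0:ℝ) < 3)) (fun f => closedBall_subset_cruxWulffBody (A f))
    exact le_trans (mul_nonneg (Real.sqrt_nonneg 3) ENNReal.toReal_nonneg) h
  have hfa0 : ∀ j j', 0 ≤ fa j j' := fun j j' => ENNReal.toReal_nonneg
  have hΘ0 : 0 ≤ Θ := Finset.sum_nonneg fun j _ => Finset.sum_nonneg fun j' _ => by
    split_ifs; exacts [le_rfl, mul_nonneg (ht0 j j') (hfa0 j j')]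
  set V : ℝ := (volume (⋃ j, Q j)).toReal with hV
  have hV0 : 0 ≤ V := ENNReal.toReal_nonneg
  have hE'top : volume (⋃ j, Q j) ≠ ⊤ := by
    refine (lt_of_le_of_lt (measure_iUnion_le _) ?_).ne
    rw [tsum_fintype]
    exact ENNReal.sum_lt_top.2 fun f _ => hvolQ f
  by_cases hE'0 : volume (⋃ j, Q j) = 0
  · have hV00 : V = 0 := by rw [hV, hE'0, ENNReal.toReal_zero]
    rw [hV00, mul_zero, Real.zero_rpow (by norm_num), mul_zero]
    exact add_nonneg hFr0 hΘ0
  have hVpos : 0 < V := ENNReal.toReal_pos hE'0 hE'top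
  set c : ℝ := (32 : ℝ) ^ ((3 : ℝ)⁻¹) with hc
  have hc0 : 0 < c := by positivity
  set x : ℝ := V ^ ((3 : ℝ)⁻¹) with hx
  have hxpos : 0 < x := Real.rpow_pos_of_pos hVpos _
  have hx3 : x ^ 3 = V := by
    rw [hx, show ((3 : ℝ)⁻¹) = ((3 : ℕ) : ℝ)⁻¹ by norm_num]
    exact Real.rpow_inv_natCast_pow hV0 (by norm_num)
  -- the chimera neighbourhood of radius `r`, cells trimmed by `r·t j j'` along every separating plane
  have key : ∀ ε : ℝ, 0 < ε → 3 * c * x ^ 2 ≤ F + Θ + ε := by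
    intro ε hε
    set ε₁ : ℝ := ε / 3 with hε₁
    have hε₁0 : 0 < ε₁ := by positivity
    obtain ⟨r₀, hr₀, hup⟩ := volume_chimera_texture_le Q hPolyQ hvolQ hdisj (fun f => W (A f))
      hWc hWv hW0 hWs hε₁0
    -- the slack `η` (keeps the trim depths positive) and the facet-slab tolerance `ε₂`
    set Sfa : ℝ := ∑ j, ∑ j', (fa j j' + 1) with hSfa
    have hSfa0 : 0 < Sfa := by
      obtain ⟨x₀, hx₀⟩ := nonempty_of_measure_ne_zero hE'0
      obtain ⟨j₀, -⟩ := mem_iUnion.1 hx₀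
      exact Finset.sum_pos (fun j _ => Finset.sum_pos (fun j' _ => by linarith [hfa0 j j'])
        ⟨j₀, Finset.mem_univ _⟩) ⟨j₀, Finset.mem_univ _⟩
    set η : ℝ := ε₁ / (2 * Sfa) with hη
    have hη0 : 0 < η := div_pos hε₁0 (by linarith)
    have hηS : η * Sfa ≤ ε₁ / 2 := by
      have e : η * Sfa = ε₁ / 2 := by rw [hη]; field_simp
      rw [e]
    set St : ℝ := ∑ j, ∑ j', (t j j' + η + 1) with hSt
    have hSt0 : 0 < St := by
      obtain ⟨x₀, hx₀⟩ := nonempty_of_measure_ne_zero hE'0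
      obtain ⟨j₀, -⟩ := mem_iUnion.1 hx₀
      exact Finset.sum_pos (fun j _ => Finset.sum_pos (fun j' _ => by linarith [ht0 j j', hη0])
        ⟨j₀, Finset.mem_univ _⟩) ⟨j₀, Finset.mem_univ _⟩
    set ε₂ : ℝ := ε₁ / (2 * St) with hε₂
    have hε₂0 : 0 < ε₂ := div_pos hε₁0 (by linarith)
    have hε₂S : ε₂ * St ≤ ε₁ / 2 := by
      have e : ε₂ * St = ε₁ / 2 := by rw [hε₂]; field_simp
      rw [e]
    have hslab : ∀ j j', ∃ δ : ℝ, 0 < δ ∧ ∀ s : ℝ, 0 < s → s < δ → j ≠ j' →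
        (volume (Q j ∩ {x : E3 | b j j' - s < ⟪nv j j', x⟫_ℝ})).toReal ≤ s * (fa j j' + ε₂) := by
      intro j j'
      by_cases hjj' : j = j'
      · exact ⟨1, one_pos, fun s _ _ h => absurd hjj' h⟩
      obtain ⟨δ, hδ, h⟩ := volume_sepSlab_le (H j) (hbd j) (hunitH j) (hunit j j' hjj') (hsep j j' hjj') hε₂0
      exact ⟨δ, hδ, fun s hs hsδ _ => h s hs hsδ⟩
    choose δ hδpos hδ using hslab
    obtain ⟨x₀, hx₀⟩ := nonempty_of_measure_ne_zero hE'0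
    obtain ⟨j₀, -⟩ := mem_iUnion.1 hx₀
    have huniv : (Finset.univ : Finset (Fin k × Fin k)).Nonempty := ⟨(j₀, j₀), Finset.mem_univ _⟩
    set δbar : ℝ := Finset.univ.inf' huniv (fun p : Fin k × Fin k => δ p.1 p.2) with hδbar
    have hδbar_pos : 0 < δbar := by
      rw [hδbar, Finset.lt_inf'_iff]; intro p _; exact hδpos p.1 p.2
    have hδbar_le : ∀ j j', δbar ≤ δ j j' := fun j j' =>
      Finset.inf'_le (fun p : Fin k × Fin k => δ p.1 p.2) (Finset.mem_univ (j, j'))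
    set tmax : ℝ := ∑ j, ∑ j', (t j j' + η + 1) with htmax
    have htmax0 : 0 < tmax := hSt0
    have htle : ∀ j j', t j j' + η ≤ tmax := by
      intro j j'
      rw [htmax]
      have hnn : ∀ i j'', 0 ≤ t i j'' + η + 1 := fun i j'' => by linarith [ht0 i j'', hη0.le]
      calc t j j' + η ≤ t j j' + η + 1 := by linarith
        _ ≤ ∑ j'', (t j j'' + η + 1) :=
            Finset.single_le_sum (f := fun j'' => t j j'' + η + 1) (fun j'' _ => hnn j j'')
              (Finset.mem_univ j')
        _ ≤ ∑ i, ∑ j'', (t i j'' + η + 1) :=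
            Finset.single_le_sum (f := fun i => ∑ j'', (t i j'' + η + 1))
              (fun i _ => Finset.sum_nonneg fun j'' _ => hnn i j'') (Finset.mem_univ j)
    -- the radius
    have hA1 : 0 < 2 * (Θ + ε₁ + 1) := by linarith
    have hA2 : 0 < 3 * c * (Θ + ε₁) + 1 := by
      have : 0 ≤ 3 * c * (Θ + ε₁) := mul_nonneg (mul_nonneg (by norm_num) hc0.le) (by linarith)
      linarith
    have hr₁0 : 0 < V / (2 * (Θ + ε₁ + 1)) := div_pos hVpos hA1
    have hr₂0 : 0 < ε₁ * x / (3 * c * (Θ + ε₁) + 1) := div_pos (mul_pos hε₁0 hxpos) hA2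
    set r : ℝ := min (min (r₀ / 2) (δbar / (2 * tmax))) (min (V / (2 * (Θ + ε₁ + 1)))
      (ε₁ * x / (3 * c * (Θ + ε₁) + 1))) with hr
    have hr0 : 0 < r :=
      lt_min (lt_min (by linarith) (div_pos hδbar_pos (by linarith))) (lt_min hr₁0 hr₂0)
    have hrr₀ : r < r₀ := lt_of_le_of_lt ((min_le_left _ _).trans (min_le_left _ _)) (by linarith)
    have hrt : ∀ j j', r * (t j j' + η) < δ j j' := by
      intro j j'
      have h1 : r ≤ δbar / (2 * tmax) := (min_le_left _ _).trans (min_le_right _ _)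
      have h2 : r * (t j j' + η) ≤ δbar / (2 * tmax) * tmax :=
        mul_le_mul h1 (htle j j') (by linarith [ht0 j j', hη0.le])
          (div_nonneg hδbar_pos.le (by linarith))
      have h3 : δbar / (2 * tmax) * tmax = δbar / 2 := by field_simp
      linarith [hδbar_le j j']
    have hrV : r * (Θ + ε₁) ≤ V / 2 := by
      have h1 : r ≤ V / (2 * (Θ + ε₁ + 1)) := (min_le_right _ _).trans (min_le_left _ _)
      rw [le_div_iff₀ hA1] at h1
      have h3 : r * (Θ + ε₁) ≤ r * (Θ + ε₁ + 1) := mul_le_mul_of_nonneg_left (by linarith) hr0.le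
      have h4 : r * (2 * (Θ + ε₁ + 1)) = 2 * (r * (Θ + ε₁ + 1)) := by ring
      linarith
    have hrx : 3 * c * (r * (Θ + ε₁)) / x ≤ ε₁ := by
      have h1 : r ≤ ε₁ * x / (3 * c * (Θ + ε₁) + 1) := (min_le_right _ _).trans (min_le_right _ _)
      rw [le_div_iff₀ hA2] at h1
      rw [div_le_iff₀ hxpos]
      have h2 : r * (3 * c * (Θ + ε₁)) ≤ r * (3 * c * (Θ + ε₁) + 1) :=
        mul_le_mul_of_nonneg_left (by linarith) hr0.le
      have h3 : 3 * c * (r * (Θ + ε₁)) = r * (3 * c * (Θ + ε₁)) := by ring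
      linarith
    -- the trimmed cells
    set Q' : Fin k → Set E3 := fun j => Q j ∩ {x : E3 | ∀ j', j' ≠ j → ⟪nv j j', x⟫_ℝ < b j j' - r * t j j'}
      with hQ'
    have hQ'sub : ∀ j, Q' j ⊆ Q j := fun j => inter_subset_left
    -- volume of the trimmed family
    have hcov : (⋃ j, Q j) ⊆ (⋃ j, Q' j) ∪ ⋃ j, ⋃ j' ∈ Finset.univ.filter (fun j' => j' ≠ j),
        (Q j ∩ {x : E3 | b j j' - r * (t j j' + η) < ⟪nv j j', x⟫_ℝ}) := by
      intro x hx
      obtain ⟨j, hxj⟩ := mem_iUnion.1 hx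
      by_cases h : ∀ j', j' ≠ j → ⟪nv j j', x⟫_ℝ < b j j' - r * t j j'
      · exact Or.inl (mem_iUnion.2 ⟨j, hxj, h⟩)
      · simp only [not_forall, not_lt] at h
        obtain ⟨j', hj', hle⟩ := h
        refine Or.inr (mem_iUnion.2 ⟨j, mem_iUnion₂.2 ⟨j', Finset.mem_filter.2 ⟨Finset.mem_univ _, hj'⟩,
          hxj, ?_⟩⟩)
        show b j j' - r * (t j j' + η) < ⟪nv j j', x⟫_ℝ
        have hpos : 0 < r * η := mul_pos hr0 hη0
        have heq : r * (t j j' + η) = r * t j j' + r * η := by ring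
        linarith
    have hV'top : volume (⋃ j, Q' j) ≠ ⊤ :=
      (lt_of_le_of_lt (measure_mono (iUnion_mono hQ'sub)) hE'top.lt_top).ne
    set V' : ℝ := (volume (⋃ j, Q' j)).toReal with hV'
    have hV'0 : 0 ≤ V' := ENNReal.toReal_nonneg
    have hlay : ∀ j, ∀ j' ∈ Finset.univ.filter (fun j' => j' ≠ j),
        (volume (Q j ∩ {x : E3 | b j j' - r * (t j j' + η) < ⟪nv j j', x⟫_ℝ})).toReal ≤
          r * (t j j' + η) * (fa j j' + ε₂) := by
      intro j j' hj'
      rw [Finset.mem_filter] at hj'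
      have hs : 0 < r * (t j j' + η) := mul_pos hr0 (by linarith [ht0 j j', hη0])
      have h := hδ j j' (r * (t j j' + η)) hs (hrt j j') (Ne.symm hj'.2)
      exact h
    have hlayfin : ∀ j j', volume (Q j ∩ {x : E3 | b j j' - r * (t j j' + η) < ⟪nv j j', x⟫_ℝ}) ≠ ⊤ :=
      fun j j' => (lt_of_le_of_lt (measure_mono inter_subset_left) (hvolQ j)).ne
    have hVV' : V ≤ V' + r * (Θ + ε₁) := by
      have h1 : volume (⋃ j, Q j) ≤ volume (⋃ j, Q' j) +
          ∑ j, ∑ j' ∈ Finset.univ.filter (fun j' => j' ≠ j),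
            volume (Q j ∩ {x : E3 | b j j' - r * (t j j' + η) < ⟪nv j j', x⟫_ℝ}) := by
        refine (measure_mono hcov).trans ((measure_union_le _ _).trans (add_le_add le_rfl ?_))
        refine (measure_iUnion_le _).trans ?_
        rw [tsum_fintype]
        exact Finset.sum_le_sum fun j _ => measure_biUnion_finset_le _ _
      have hsumfin : ∑ j, ∑ j' ∈ Finset.univ.filter (fun j' => j' ≠ j),
          volume (Q j ∩ {x : E3 | b j j' - r * (t j j' + η) < ⟪nv j j', x⟫_ℝ}) ≠ ⊤ :=
        ENNReal.sum_ne_top.2 fun j _ => ENNReal.sum_ne_top.2 fun j' _ => hlayfin j j'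
      have h2 := ENNReal.toReal_mono (ENNReal.add_ne_top.2 ⟨hV'top, hsumfin⟩) h1
      rw [ENNReal.toReal_add hV'top hsumfin, ENNReal.toReal_sum (fun j _ =>
        ENNReal.sum_ne_top.2 fun j' _ => hlayfin j j')] at h2
      have h3 : ∑ j, (∑ j' ∈ Finset.univ.filter (fun j' => j' ≠ j),
          volume (Q j ∩ {x : E3 | b j j' - r * (t j j' + η) < ⟪nv j j', x⟫_ℝ})).toReal ≤
          ∑ j, ∑ j' ∈ Finset.univ.filter (fun j' => j' ≠ j), r * (t j j' + η) * (fa j j' + ε₂) := by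
        refine Finset.sum_le_sum fun j _ => ?_
        rw [ENNReal.toReal_sum (fun j' _ => hlayfin j j')]
        exact Finset.sum_le_sum (hlay j)
      -- bound the double sum by `r (Θ + ε₁)`
      have h4 : ∑ j, ∑ j' ∈ Finset.univ.filter (fun j' => j' ≠ j), r * (t j j' + η) * (fa j j' + ε₂) ≤
          r * (Θ + ε₁) := by
        have e1 : ∑ j, ∑ j' ∈ Finset.univ.filter (fun j' => j' ≠ j), r * (t j j' + η) * (fa j j' + ε₂) =
            r * (∑ j, ∑ j' ∈ Finset.univ.filter (fun j' => j' ≠ j), t j j' * fa j j') +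
            r * (η * ∑ j, ∑ j' ∈ Finset.univ.filter (fun j' => j' ≠ j), fa j j') +
            r * (ε₂ * ∑ j, ∑ j' ∈ Finset.univ.filter (fun j' => j' ≠ j), (t j j' + η)) := by
          rw [Finset.mul_sum, Finset.mul_sum, Finset.mul_sum, Finset.mul_sum, Finset.mul_sum,
            ← Finset.sum_add_distrib, ← Finset.sum_add_distrib]
          refine Finset.sum_congr rfl fun j _ => ?_
          rw [Finset.mul_sum, Finset.mul_sum, Finset.mul_sum, Finset.mul_sum, Finset.mul_sum,
            ← Finset.sum_add_distrib, ← Finset.sum_add_distrib]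
          refine Finset.sum_congr rfl fun j' _ => ?_
          ring
        have e2 : ∑ j, ∑ j' ∈ Finset.univ.filter (fun j' => j' ≠ j), t j j' * fa j j' = Θ := by
          rw [hΘ]
          refine Finset.sum_congr rfl fun j _ => ?_
          rw [Finset.sum_filter]
          refine Finset.sum_congr rfl fun j' _ => ?_
          by_cases h : j' ≠ j
          · rw [if_pos h, if_neg (Ne.symm h)]
          · rw [if_neg h, if_pos (not_ne_iff.1 h).symm]
        have e3 : ∑ j, ∑ j' ∈ Finset.univ.filter (fun j' => j' ≠ j), fa j j' ≤ Sfa := by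
          rw [hSfa]
          refine Finset.sum_le_sum fun j _ => ?_
          calc ∑ j' ∈ Finset.univ.filter (fun j' => j' ≠ j), fa j j'
              ≤ ∑ j', fa j j' := Finset.sum_le_sum_of_subset_of_nonneg (Finset.filter_subset _ _)
                  (fun j' _ _ => hfa0 j j')
            _ ≤ ∑ j', (fa j j' + 1) := Finset.sum_le_sum fun j' _ => by linarith
        have e4 : ∑ j, ∑ j' ∈ Finset.univ.filter (fun j' => j' ≠ j), (t j j' + η) ≤ St := by
          rw [hSt]
          refine Finset.sum_le_sum fun j _ => ?_
          calc ∑ j' ∈ Finset.univ.filter (fun j' => j' ≠ j), (t j j' + η)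
              ≤ ∑ j', (t j j' + η) := Finset.sum_le_sum_of_subset_of_nonneg (Finset.filter_subset _ _)
                  (fun j' _ _ => by linarith [ht0 j j', hη0.le])
            _ ≤ ∑ j', (t j j' + η + 1) := Finset.sum_le_sum fun j' _ => by linarith
        rw [e1, e2]
        have h5 : η * ∑ j, ∑ j' ∈ Finset.univ.filter (fun j' => j' ≠ j), fa j j' ≤ ε₁ / 2 :=
          (mul_le_mul_of_nonneg_left e3 hη0.le).trans hηS
        have h6 : ε₂ * ∑ j, ∑ j' ∈ Finset.univ.filter (fun j' => j' ≠ j), (t j j' + η) ≤ ε₁ / 2 :=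
          (mul_le_mul_of_nonneg_left e4 hε₂0.le).trans hε₂S
        have h7 := mul_le_mul_of_nonneg_left h5 hr0.le
        have h8 := mul_le_mul_of_nonneg_left h6 hr0.le
        have e9 : r * (Θ + ε₁) = r * Θ + r * (ε₁ / 2) + r * (ε₁ / 2) := by ring
        rw [e9]
        linarith [h7, h8]
      linarith [h2, h3, h4]
    -- the trimmed family is not null
    have hV'pos : 0 < V' := by linarith [hVV', hrV, hVpos]
    have hE''0 : volume (⋃ j, Q' j) ≠ 0 := by
      intro h; rw [hV', h, ENNReal.toReal_zero] at hV'pos; exact lt_irrefl _ hV'pos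
    -- the chimera set
    set Cr : Set E3 := ⋃ f, ⋃ x ∈ Q f, x +ᵥ (r • W (A f)) with hCr
    have hCfin : volume Cr ≠ ⊤ := by
      obtain ⟨R₁, hR₁⟩ := (Bornology.isBounded_iUnion.2 hbd).subset_closedBall 0
      have hCsub : Cr ⊆ Metric.closedBall (0 : E3) (R₁ + r * Real.sqrt 5) := by
        intro y hy
        simp only [hCr, mem_iUnion, Set.mem_vadd_set, vadd_eq_add, exists_prop] at hy
        obtain ⟨f, x', hx', w, hw, rfl⟩ := hy
        obtain ⟨w', hw', rfl⟩ := Set.mem_smul_set.1 hw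
        have hx'' : ‖x'‖ ≤ R₁ := mem_closedBall_zero_iff.1 (hR₁ (mem_iUnion.2 ⟨f, hx'⟩))
        have hw'' : ‖w'‖ ≤ Real.sqrt 5 :=
          mem_closedBall_zero_iff.1 (cruxWulffBody_subset_closedBall (A f) hw')
        rw [mem_closedBall_zero_iff]
        calc ‖x' + r • w'‖ ≤ ‖x'‖ + ‖r • w'‖ := norm_add_le _ _
          _ = ‖x'‖ + r * ‖w'‖ := by rw [norm_smul, Real.norm_of_nonneg hr0.le]
          _ ≤ R₁ + r * Real.sqrt 5 := by gcongr
      exact (lt_of_le_of_lt (measure_mono hCsub) measure_closedBall_lt_top).ne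
    -- target volumes relative to the trimmed family (`κ = 32·V'/V`)
    set κ : ℝ := 32 * V' / V with hκ
    have hκ0 : 0 < κ := div_pos (mul_pos (by norm_num) hV'pos) hVpos
    have hQ'fin : ∀ j, volume (Q' j) ≠ ⊤ := fun j =>
      (lt_of_le_of_lt (measure_mono (hQ'sub j)) (hvolQ j)).ne
    have hTvol : ∀ j, ENNReal.ofReal (κ * ((volume (Q' j)).toReal / (volume (⋃ j, Q' j)).toReal)) ≤
        volume (W (A j) ∩ ⋂ j' ∈ Finset.univ.filter (fun j' => j' ≠ j), {y : E3 | ⟪y, nv j j'⟫_ℝ ≤ τ j j'}) := by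
      intro j
      refine le_trans (ENNReal.ofReal_le_ofReal ?_) (hfeas j)
      show κ * ((volume (Q' j)).toReal / V') ≤ 32 * ((volume (Q j)).toReal / V)
      have hq : (volume (Q' j)).toReal ≤ (volume (Q j)).toReal :=
        ENNReal.toReal_mono (hvolQ j).ne (measure_mono (hQ'sub j))
      have e1 : κ * ((volume (Q' j)).toReal / V') = 32 * ((volume (Q' j)).toReal / V) := by
        rw [hκ]; field_simp
      rw [e1]
      exact mul_le_mul_of_nonneg_left (div_le_div_of_nonneg_right hq hV0) (by norm_num)
    have hlow := gapCells_chimera_lower Q A nv b τ t hQo hanti hbanti hsep hgap hr0 hκ0 hE''0 hV'top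
      hTvol (U := Cr) (fun j x hx w hw => mem_iUnion.2 ⟨j, mem_iUnion₂.2 ⟨x, hx,
        Set.mem_vadd_set.2 ⟨r • w, Set.smul_mem_smul_set hw, rfl⟩⟩⟩)
    have hlow' : volume (⋃ j, Q' j) ^ ((3 : ℕ)⁻¹ : ℝ) +
        ENNReal.ofReal r * (ENNReal.ofReal κ) ^ ((3 : ℕ)⁻¹ : ℝ) ≤ volume Cr ^ ((3 : ℕ)⁻¹ : ℝ) := hlow
    have hupC : (volume Cr).toReal ≤ V + r * (F + ε₁) := hup r hr0 hrr₀
    clear_value Q' Cr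
    -- to real numbers
    have hexp : (((3 : ℕ) : ℝ)⁻¹) = (3 : ℝ)⁻¹ := by norm_num
    set c' : ℝ := κ ^ ((3 : ℝ)⁻¹) with hc'
    have hc'0 : 0 ≤ c' := Real.rpow_nonneg hκ0.le _
    have h1 : V' ^ ((3 : ℝ)⁻¹) + r * c' ≤ (volume Cr).toReal ^ ((3 : ℝ)⁻¹) := by
      have h := ENNReal.toReal_mono (ENNReal.rpow_ne_top_of_nonneg (by positivity) hCfin) hlow'
      rw [ENNReal.toReal_add (ENNReal.rpow_ne_top_of_nonneg (by positivity) hV'top)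
          (ENNReal.mul_ne_top ENNReal.ofReal_ne_top (ENNReal.rpow_ne_top_of_nonneg (by positivity)
            ENNReal.ofReal_ne_top)),
        ENNReal.toReal_mul, ENNReal.toReal_ofReal hr0.le, ← ENNReal.toReal_rpow, ← ENNReal.toReal_rpow,
        ← ENNReal.toReal_rpow, ENNReal.toReal_ofReal hκ0.le, hexp] at h
      exact h
    set y : ℝ := V' ^ ((3 : ℝ)⁻¹) with hy
    have hy0 : 0 ≤ y := Real.rpow_nonneg hV'0 _
    have hy3 : y ^ 3 = V' := by
      rw [hy, show ((3 : ℝ)⁻¹) = ((3 : ℕ) : ℝ)⁻¹ by norm_num]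
      exact Real.rpow_inv_natCast_pow hV'0 (by norm_num)
    have hC3 : ((volume Cr).toReal ^ ((3 : ℝ)⁻¹)) ^ 3 = (volume Cr).toReal := by
      rw [show ((3 : ℝ)⁻¹) = ((3 : ℕ) : ℝ)⁻¹ by norm_num]
      exact Real.rpow_inv_natCast_pow ENNReal.toReal_nonneg (by norm_num)
    have h2' : (y + r * c') ^ 3 ≤ ((volume Cr).toReal ^ ((3 : ℝ)⁻¹)) ^ 3 :=
      pow_le_pow_left₀ (add_nonneg hy0 (mul_nonneg hr0.le hc'0)) h1 3
    rw [hC3] at h2'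
    have h2 : (y + r * c') ^ 3 ≤ V + r * (F + ε₁) := h2'.trans hupC
    have hc'eq : c' = c * y / x := by
      have e1 : κ = 32 * (V' / V) := by rw [hκ]; ring
      rw [hc', e1, Real.mul_rpow (by norm_num) (div_nonneg hV'0 hV0), Real.div_rpow hV'0 hV0, hc, hy, hx]
      ring
    have hc'y : c' * y ^ 2 = c * V' / x := by
      calc c' * y ^ 2 = c * y / x * y ^ 2 := by rw [hc'eq]
        _ = c * y ^ 3 / x := by ring
        _ = c * V' / x := by rw [hy3]
    have h3 : r * (3 * c * V' / x) ≤ r * (F + Θ + 2 * ε₁) := by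
      have hrc : 0 ≤ r * c' := mul_nonneg hr0.le hc'0
      have hexp3 : y ^ 3 + 3 * y ^ 2 * (r * c') ≤ (y + r * c') ^ 3 := by
        have hcube : (y + r * c') ^ 3 = y ^ 3 + 3 * y ^ 2 * (r * c') + (3 * y * (r * c') ^ 2 + (r * c') ^ 3) := by
          ring
        have hnn : 0 ≤ 3 * y * (r * c') ^ 2 + (r * c') ^ 3 :=
          add_nonneg (mul_nonneg (mul_nonneg (by norm_num) hy0) (sq_nonneg _)) (pow_nonneg hrc 3)
        rw [hcube]; linarith
      have e1 : r * (3 * c * V' / x) = 3 * y ^ 2 * (r * c') := by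
        have : 3 * y ^ 2 * (r * c') = 3 * r * (c' * y ^ 2) := by ring
        rw [this, hc'y]; ring
      rw [e1]
      calc 3 * y ^ 2 * (r * c') ≤ (y + r * c') ^ 3 - y ^ 3 := by linarith [hexp3]
        _ ≤ V + r * (F + ε₁) - V' := by linarith [h2, hy3]
        _ ≤ r * (F + ε₁) + r * (Θ + ε₁) := by linarith [hVV']
        _ = r * (F + Θ + 2 * ε₁) := by ring
    have h4 : 3 * c * V' / x ≤ F + Θ + 2 * ε₁ := le_of_mul_le_mul_left h3 hr0
    have h5 : 3 * c * x ^ 2 = 3 * c * V / x := by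
      rw [← hx3]; field_simp
    have h6 : 3 * c * V / x ≤ 3 * c * V' / x + 3 * c * (r * (Θ + ε₁)) / x := by
      rw [← add_div]
      exact div_le_div_of_nonneg_right (by nlinarith [hVV', hc0.le]) hxpos.le
    have : 2 * ε₁ + ε₁ = ε := by rw [hε₁]; ring
    linarith [h4, h5, h6, hrx]
  have hfin : 3 * c * x ^ 2 ≤ F + Θ := le_of_forall_pos_le_add fun ε hε => by linarith [key ε hε]
  rw [wulff_constant_eq hV0]
  exact hfin

end Summit.Ventures.Crystal3D.Cruxes.PolycrystalWulffBound.PolyDensity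

end
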